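import Literature.GroupTheory.CombinatorialGroupTheory.FreeProductFibredTwist
import Literature.GroupTheory.CombinatorialGroupTheory.PuncturedSurfaceGroupClosedCase
import Literature.GroupTheory.CombinatorialGroupTheory.PuncturedSurfaceGroupCusps
import Mathlib.Data.ZMod.Basic
import HarnessLib

/-!
# Separating normal subgroups in a free product of closed surface groups ([CombGC] Prop. 1.2 proof p. 9, `Π^unr` side, discrete form)

Topic `Literature/GroupTheory/CombinatorialGroupTheory`; theorems only.  [CombGC] Def. 1.1 (ii) / Prop. 1.2
proof p. 9 [cite: MochizukiCombGC2007, Prop 1.2 proof p.9]: for a STURDY two-component pointed stable curve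
the unramified quotient `Π^unr_G` is the pro-`Σ` completion of `Γ^unr = Γ_{g₀,0} ∗ Γ_{g₁,0}` (`g₀, g₁ ≥ 2`),
the free product of the two CLOSED surface groups, and the `Π^unr`-verticial separating covering (FACT row
F-2828, sub-DAG row P12-L01-U) is, at the discrete level, a normal subgroup `U ⊴ N` of a level `N ⊴ Γ^unr`
nontrivial over one vertex `f Γ_{g₀,0} f⁻¹ ∩ N` and trivial over the others.  This PROOF-ONLY file
(abc-iut-f-166 gen 3) supplies that discrete statement from the free-product fibred twist
(`FreeProductFibredTwist.lean`) and Riemann–Hurwitz for closed surface groups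
(`PuncturedSurfaceGroupClosedCase.finiteIndexSubgroup_zero`, Zieschang–Vogt–Coldewey 4.14.22):

* `PuncturedSurfaceGroup.exists_handleCharacter_zero` — characters of `Γ_{g,0}` with prescribed handle
  values in a commutative group;
* `PuncturedSurfaceGroup.exists_character_ne_one_of_finiteIndex_zero` — every finite-index subgroup of
  `Γ_{g,0}`, `g ≥ 2`, has a nontrivial character to `ℤ/n` (`n ≥ 2`): it is a `Γ_{g',0}`, `g' ≥ 2`;
* `exists_normal_separating_surfaceFreeProduct` — **for `Γ ≅ Γ_{g₀,0} ∗ Γ_{g₁,0}`, `g₀ ≥ 2`, a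
  finite-index `N ⊴ Γ`, `n ≥ 2` and `f ∈ Γ`: there is `U ⊴ N` of finite index dividing `n` with
  `f (A' ∩ N) f⁻¹ ⊄ U` and `g (A' ∩ N) g⁻¹ ⊆ U` whenever `f⁻¹ g ∉ A' N`** (`A'` the image of `Γ_{g₀,0}`).

What remains for the kernel `Π^unr` clause at sturdy data is the identification of `Π/unrKer` with a
pro-`Σ` completion of this free product (Tietze `Γ_{g,r}/⟨⟨c_j, ε⟩⟩ ≅ Γ_{g₀,0} ∗ Γ_{g−g₀,0}` + completion of
quotients) — not done here.  Nothing here concerns [IUTchIII].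
-/

namespace Literature.GroupTheory.CombinatorialGroupTheory

open Monoid (Coprod)
open scoped Pointwise

namespace PuncturedSurfaceGroup

/-- **Characters of the closed surface group `Γ_{g,0}` with prescribed handle values** in a commutative
group (the relator `∏[a_i,b_i]` dies). [cite: ZieschangVogtColdewey1980, Thm 4.14.22 / Prop 4.14.23 p.154] -/
theorem exists_handleCharacter_zero {g : ℕ} {M : Type*} [CommGroup M] (wa wb : Fin g → M) :
    ∃ φ : PuncturedSurfaceGroup g 0 →* M, (∀ i, φ (a i) = wa i) ∧ ∀ i, φ (b i) = wb i := by
  classical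
  let f : puncturedSurfaceGen g 0 → M := Sum.elim (fun q => if q.2 then wb q.1 else wa q.1) Fin.elim0
  have hrel : ∀ v ∈ ({relator g 0} : Set (FreeGroup (puncturedSurfaceGen g 0))), FreeGroup.lift f v = 1 := by
    intro v hv
    rw [Set.mem_singleton_iff] at hv
    rw [hv, lift_relator]
    have h1 : ((List.finRange g).map fun i =>
        f (Sum.inl (i, false)) * f (Sum.inl (i, true)) * (f (Sum.inl (i, false)))⁻¹ *
          (f (Sum.inl (i, true)))⁻¹).prod = 1 :=
      List.prod_eq_one fun y hy => by
        obtain ⟨i, -, rfl⟩ := List.mem_map.mp hy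
        rw [mul_inv_cancel_comm, mul_inv_cancel]
    rw [h1, List.finRange_zero, List.map_nil, List.prod_nil, mul_one]
  refine ⟨PresentedGroup.toGroup hrel, fun i => ?_, fun i => ?_⟩
  · change PresentedGroup.toGroup hrel (PresentedGroup.of (Sum.inl (i, false))) = wa i
    rw [PresentedGroup.toGroup.of]
    simp [f]
  · change PresentedGroup.toGroup hrel (PresentedGroup.of (Sum.inl (i, true))) = wb i
    rw [PresentedGroup.toGroup.of]
    simp [f]

/-- **Finite-index subgroups of a closed surface group have nontrivial characters.**  For `g ≥ 2`,
`K ≤ Γ_{g,0}` of finite index and `n ≥ 2` there is a homomorphism `φ : K → ℤ/n` and `x ∈ K` with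
`φ x ≠ 1`: `K ≅ Γ_{g',0}` with `g' ≥ 2` (Riemann–Hurwitz), and a handle character of `Γ_{g',0}` transports.
[cite: ZieschangVogtColdewey1980, Thm 4.14.22 / Prop 4.14.23 p.154] -/
theorem exists_character_ne_one_of_finiteIndex_zero {g : ℕ} (hg : 2 ≤ g)
    (K : Subgroup (PuncturedSurfaceGroup g 0)) [K.FiniteIndex] {n : ℕ} (hn : 2 ≤ n) :
    ∃ (φ : K →* Multiplicative (ZMod n)) (x : K), φ x ≠ 1 := by
  classical
  haveI : NeZero n := ⟨by omega⟩
  have hgt : IsHyperbolicType g 0 := by unfold IsHyperbolicType; omega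
  obtain ⟨g', r', θ, cusp, rep, hh, hθinj, hθr, -, -, -⟩ := finiteIndexSubgroup_zero g hgt K
  have hr' : r' = 0 := by
    rcases Nat.eq_zero_or_pos r' with h | h
    · exact h
    · exact Fin.elim0 (cusp ⟨0, h⟩)
  subst hr'
  have hg' : 0 < g' := by unfold IsHyperbolicType at hh; omega
  -- the handle character `a_0 ↦ 1̄` of `Γ_{g',0}`
  obtain ⟨χ, hχa, -⟩ := exists_handleCharacter_zero (g := g') (M := Multiplicative (ZMod n))
    (fun i => if i = ⟨0, hg'⟩ then Multiplicative.ofAdd 1 else 1) (fun _ => 1)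
  have hχ0 : χ (a ⟨0, hg'⟩) = Multiplicative.ofAdd 1 := by rw [hχa, if_pos rfl]
  -- transport along `θ : Γ_{g',0} ≅ K`
  let e : PuncturedSurfaceGroup g' 0 ≃* K :=
    (MonoidHom.ofInjective hθinj).trans (MulEquiv.subgroupCongr hθr)
  refine ⟨χ.comp e.symm.toMonoidHom, e (a ⟨0, hg'⟩), ?_⟩
  rw [MonoidHom.comp_apply, MulEquiv.coe_toMonoidHom, MulEquiv.symm_apply_apply, hχ0]
  intro h
  have h1 : (1 : ZMod n) = 0 := Multiplicative.ofAdd.injective (h.trans ofAdd_zero.symm)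
  have h2 : (1 : ZMod n).val = 0 := by rw [h1, ZMod.val_zero]
  rw [ZMod.val_one'' (by omega)] at h2
  exact one_ne_zero h2

end PuncturedSurfaceGroup

/-- **Separating normal subgroups in `Γ_{g₀,0} ∗ Γ_{g₁,0}`** ([CombGC] Prop. 1.2 proof p. 9, `Π^unr`-verticial
case at the discrete level): for `Γ ≅ Γ_{g₀,0} ∗ Γ_{g₁,0}` with `g₀ ≥ 2`, `A'` the image of the first factor,
a finite-index `N ⊴ Γ`, `n ≥ 2` and `f ∈ Γ`, there is `U ⊴ N` of finite index dividing `n` with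
`f (A' ∩ N) f⁻¹ ⊄ U` ("nontrivial over the vertex of `f`") and `g (A' ∩ N) g⁻¹ ⊆ U` for all `g` with
`f⁻¹ g ∉ A'·N` ("trivial over every other vertex"). [cite: MochizukiCombGC2007, Prop 1.2 proof p.9] -/
theorem exists_normal_separating_surfaceFreeProduct {g₀ g₁ : ℕ} (hg₀ : 2 ≤ g₀) {Γ : Type*} [Group Γ]
    (e : Coprod (PuncturedSurfaceGroup g₀ 0) (PuncturedSurfaceGroup g₁ 0) ≃* Γ)
    (A' : Subgroup Γ)
    (hA' : A' = (e.toMonoidHom.comp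
      (Coprod.inl : PuncturedSurfaceGroup g₀ 0 →* Coprod (PuncturedSurfaceGroup g₀ 0) (PuncturedSurfaceGroup g₁ 0))).range)
    (N : Subgroup Γ) [hN : N.Normal] [N.FiniteIndex] {n : ℕ} (hn : 2 ≤ n) (f : Γ) :
    ∃ U : Subgroup N, U.Normal ∧ U.index ∣ n ∧ U.FiniteIndex ∧
      ¬ (ConjAct.toConjAct f • (A' ⊓ N) ≤ U.map N.subtype) ∧
      ∀ g : Γ, f⁻¹ * g ∉ (A' : Set Γ) * (N : Set Γ) →
        ConjAct.toConjAct g • (A' ⊓ N) ≤ U.map N.subtype := by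
  classical
  haveI : NeZero n := ⟨by omega⟩
  -- the factor embedding and its trace `K = ι⁻¹(N)` on `Γ_{g₀,0}`
  set ιA : PuncturedSurfaceGroup g₀ 0 →* Γ := e.toMonoidHom.comp
    (Coprod.inl : PuncturedSurfaceGroup g₀ 0 →* Coprod (PuncturedSurfaceGroup g₀ 0) (PuncturedSurfaceGroup g₁ 0))
    with hιA
  have hιinj : Function.Injective ιA := e.injective.comp Coprod.inl_injective
  set K : Subgroup (PuncturedSurfaceGroup g₀ 0) := N.comap ιA with hK
  haveI : K.FiniteIndex := ⟨by rw [hK, Subgroup.index_comap]; exact Subgroup.FiniteIndex.index_ne_zero⟩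
  obtain ⟨φ₀, x₀, hφ₀⟩ := PuncturedSurfaceGroup.exists_character_ne_one_of_finiteIndex_zero hg₀ K hn
  -- `K ≅ A' ∩ N` along `ιA`
  have hKmap : K.map ιA = A' ⊓ N := by
    rw [hK, Subgroup.map_comap_eq, hA', inf_comm]
  let eK : K ≃* ↥(A' ⊓ N) := (K.equivMapOfInjective ιA hιinj).trans (MulEquiv.subgroupCongr hKmap)
  let φ : ↥(A' ⊓ N) →* Multiplicative (ZMod n) := φ₀.comp eK.symm.toMonoidHom
  have hφx : φ (eK x₀) ≠ 1 := by
    change φ₀ (eK.symm (eK x₀)) ≠ 1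
    rw [MulEquiv.symm_apply_apply]
    exact hφ₀
  obtain ⟨U, hUn, hUidx, hUfi, hUf, hUg⟩ := FreeProductFibredTwist.exists_normal_separating_of_freeProduct
    e A' hA' N φ (eK x₀ : Γ) (eK x₀).2 hφx f
  refine ⟨U, hUn, ?_, hUfi, ?_, hUg⟩
  · rwa [show Nat.card (Multiplicative (ZMod n)) = n from Nat.card_zmod n] at hUidx
  · intro hle
    apply hUf
    have hm : ConjAct.toConjAct f • ((eK x₀ : ↥(A' ⊓ N)) : Γ) ∈ ConjAct.toConjAct f • (A' ⊓ N) :=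
      Subgroup.smul_mem_pointwise_smul _ _ _ (eK x₀).2
    rw [ConjAct.smul_def, ConjAct.ofConjAct_toConjAct] at hm
    exact hle hm

end Literature.GroupTheory.CombinatorialGroupTheory
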